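import Summits.QuantumFields.QCD.Theses.NestedDissectionSea
import Summits.QuantumFields.QCD.Theorems.EarlyCrosserLaw.Negative.CellPositivityDomain
import Summits.QuantumFields.QCD.Theorems.NestedDissectionSeaKineticEdge
import Summits.QuantumFields.QCD.Theorems.NestedDissectionSeaEarlyCrosserLawStubZeroExtensionQuasimode
import Summits.QuantumFields.QCD.Theorems.NestedDissectionSeaEarlyCrosserLawCellsInheritSmallBoxes
import Summits.QuantumFields.QCD.Theorems.NestedDissectionSeaEarlyCrosserLawQuasimodeKineticEdge
import Literature.MathematicalPhysics.QuantumLattice.TopologicalCriticalMass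
import HarnessLib.Audit

/-!
# Line `cells-inherit-torus-extinction` for crux `NestedDissectionSea.EarlyCrosserLaw`
# (stmt-QuantumFields-13995, rank 2 of route-QuantumFields-NestedDissectionSea) — LEAD skeleton v5 (lead c3)

Lead seats `prover-line-stmt-QuantumFields-13995-c2-0` (v2–v4) and `…-c3-0` (v5, 2026-08-16T19:2xZ). Planner skeleton: gen 2
(`planner-cruxplan-stmt-QuantumFields-13995-cells-inherit-torus--g2-0`); line card `Lines/cells-inherit-torus-extinction.md`.

## v5 (this file, lead c3) — the (a′)-stubs are made PIN-LOCAL and CAPPED (both pure weakenings; composition unchanged in idea)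

* S2′/S3′ consumed the two-sided pin as a GLOBAL hypothesis (`∀ m > M₀ ∃ R, (b)∧(b″)`) and concluded for EVERY `R > 0` — so they
  also spoke about femto tori `a_k N ∈ [R, ℓ]`, `R ≪ 1/Λ`, which the crux (whose `R` is existential, chosen after `m`) never visits and
  where the only protection of S2′ is the logarithmic growth of `Z_m` (toron quasimodes at the top window scale, FINDINGS-lead-c2 §2(i)).
  v5 states both laws AT THE PINNED DATA: `… ∀ m > M₀ ∃ c > 0 ∀ R > 0, (b at (m,R)) → (b″ at (m,R)) → dilution at (m,R)` — exactly the
  shape in which `EarlyCrosserLaw_of` uses them (the pin's own `R`), and vacuous wherever the pins cannot hold.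
* The charged events carry the MASS CAP that the landed kinetic edges give for free: S2′ `μ' + Σ_i(1 − cos(π/t_i)) ≤ c·a_k m_f/Z_m`
  (`quasimode_kineticEdge`, p108202), S3′ `μ' + Σ_i(1 − cos(π/t_i)) ≤ 0` (`kineticEdge_zeroMode`): the charged masses form the compact
  early interval `[m_f(k), cap]`, nothing at or above zero bare mass is charged.
* Companion landings of this cycle: `Theorems/NestedDissectionSeaEarlyCrosserLawNormalForm.lean` (p121074; (a′) ⟺ window-summable
  probability of ONE closed cover event per box, flag + cap included — `dilutionClause_iff_coverProbClause`, `earlyCrosserLaw_iff_coverProb`),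
  `Theorems/EarlyCrosserLaw/Negative/OnBranchWithoutLowerPin.lean` (p121089; S4′ with (b) deleted is a theorem along `canonicalAF`:
  (b) stays the only load-bearing clause ON THE BRANCH).

## v4 (lead c2) — wave-1 integration + RESHAPE "on the physical branch, kinematically allowed boxes only" (v4 = v3 with S2′
## weakened to `∃ ℓ … ∀ m ∃ c`: the prover of the hardest stub picks the physical window and an `m`-dependent level)

* S1 `stub_zeroExtensionQuasimode` LANDED (wave-1 worker, p105418,
  `Theorems/NestedDissectionSeaEarlyCrosserLawStubZeroExtensionQuasimode.lean`, true constant 16 ≤ 64) — imported, its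
  local `sorry` deleted. Composition helpers LANDED (lead, p106556,
  `Theorems/NestedDissectionSeaEarlyCrosserLawCellsInheritSmallBoxes.lean`: `outer_union_bound`, `eventually_neg_lt_valenceMass`,
  `crossing_impossible_of_side_lt`, `kineticFloor_pos`). Pin projection `pinnedLine_of_earlyCrosserLaw` LANDED (worker, p105530).
* EXPOSURE found by the wave-1 S3 worker (certified in the seat folder, `work/stubs/StubSheetAttachedRarity.lean`:
  `sheetEvent_certain_oneSite_of_le_neg_four`): the gen-2 laws S2, S3 quantified over EVERY admissible reg obeying the
  two-sided pin, but the pin only confines the line to the Wilson band `(−8, 0]` (`LowerPinLoadBearing`); at a line `≤ −4`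
  the one-site box `t = (2,2,2,2)` (admissible at every scale, every index a face index) is singular at `μ' = −4` FOR EVERY
  GAUGE FIELD (`wilsonCell_two_det_eq_zero_iff`, p74201; all even-sided boxes, `Negative/EvenCellSingular`), so S3's event is
  CERTAIN there (ratio 1, δ_j ≥ 1 > ε): S3-as-filed = S3-physics ∧ "no admissible reg is two-sidedly pinned at a line ≤ −4
  i.o." — a parity-ORIENTATION statement about the doubler lines that the crux (an `∃ reg` statement) never needs. The hinge
  `CoerciveSea` (stmt-13901) met the same exposure and repaired it the same way (its `Lines/chirality_collapses_pseudospectrum.lean`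
  v4-c1, `Theorems/NestedDissectionSeaCoerciveSeaSmallBoxes.lean` p97150) — adopted:
  - S4′ `stub_pinnedLineOnBranch`: the shared two-sided pin `(b) ∧ (b″)` with its `∃ reg`, PLUS the physical-branch clause
    `Filter.Tendsto reg.mcrit Filter.atTop (nhds 0)` for the SAME witness (the critical bare Wilson mass tends to `0` in lattice
    units along an asymptotically free trajectory, `m_c(g₀) = −g₀²Σ₁ + O(g₀⁴)`; free for any honest witness; implies gen-2's pin
    by forgetting). PLANNER: this is the clause to add to the pin of 13995/13900 (as already recommended on 13901 by its lead c1).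
  - S2′ `stub_torusLocalExtinctionOnBranch`, S3′ `stub_sheetAttachedRarityOnBranch`: the branch clause as an extra HYPOTHESIS,
    and the charged event carries the KINEMATIC FLAG `Σ_i (1 − cos(π/t_i)) ≤ −m_f(k)` per flavour — the laws charge ONLY boxes
    that can cross at all above the valence line (landed kinetic edge (a), `KineticEdge.kineticEdge_zeroMode`: a crossing at
    `μ'` needs `Σ_i(1 − cos(π/t_i)) ≤ −μ'`). Strictly weaker than gen 2: every box with `Σ(1 − cos(π/t_i)) > |m_f(k)|` — all
    boxes below `s_free(k) = π(2/|m_f(k)|)^{1/2} → ∞`, in particular every fixed-size box eventually (on the branch `m_f(k) → 0⁻`,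
    `eventually_neg_lt_valenceMass`) — is uncharged; the residual S2′/S3′ are exactly the non-kinematic (non-perturbative) tail.
  - The composition supplies the flag DETERMINISTICALLY from the crossing itself (`kineticEdge_zeroMode`), so no small-box case
    distinction is needed any more (v2's `S₀` device is superseded; its landed helpers stay available to the stub provers).
* Stubs now: closed S1 (p105418); open S2′ (lead; crux-sized physics), S3′ (wave-2 audit), S4′ (wave 1: `stub-blocked`, crux-sized).

## The crux (route file rev 24, verbatim)

`∀ N_f ∈ {2,3} ∃ reg (HasMassScaling, HasAsymptoticScaling) ∃ M₀ ≥ 0 ∃ b₀ ≥ 2 ∃ ℓ > 0 ∀ m > M₀ ∃ R > 0:`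
(a′) window dilution of EARLY CROSSERS (every event implying "some flavour `f`, some `μ' ≥ m_f(k)`, the corner-0 window box OR
ONE OF ITS 16 CHILDREN has `det wilsonCell = 0`" has phase-quenched probability `≤ δ_j`, `Σ_{j<J}δ_j ≤ ε`, eventually in `k`, on
every odd torus of physical side `≥ R`); (b) the LOWER parity pin; (b″) the UPPER parity pin.

## The line in one paragraph (unchanged idea)

An early crosser is a kernel vector `w` of a Dirichlet cell at `μ' ≥ m_f(k)` — possible only in a box with kinetic floor
`Σ(1 − cos(π/t_i)) ≤ −μ'`. Split by FACE MASS at threshold `(c·a_k m_f/(8Z_m))²‖w‖²`: face-LIGHT ⇒ (S1, landed) the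
zero-extension is a box-supported quasimode of the TORUS operator `D_W(U,μ',1)` at level `c·a_k m_f/Z_m` (a local pseudospectral
event of the Hermitian `Γ₅D_W`; note `min_{v ⊂ box} ‖D_W v̂‖/‖v̂‖ ≥ σ_min(D_W(μ')) = min |spec Γ₅D_W(μ')|`, the DGLPT-2006 gap) —
window-rare by S2′; face-HEAVY (near-sheet lumps, Kaplan/Shamir wall states) — window-rare by S3′; the pin + branch is S4′.

## Composition (`EarlyCrosserLaw_of`, sorry-free apart from the three open stubs it cites by name)

`reg, branch, M₀, pin` from S4′; `ℓ` and (after `m`) `c` from S2′; S3′ at `c, ℓ`; `b₀ := 2`; (b), (b″) verbatim; (a′): S2′, S3′ at `ε/34`,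
`δ_j := 17(δ²_j + δ³_j)`; for each of the 17 boxes a crossing at `μ' ≥ m_f(k)` yields the kinematic flag (`kineticEdge_zeroMode`)
and, by the face dichotomy + S1 (`64·(x/8)² = x²`), one of the two charged events; `outer_union_bound` (p106556) closes without
measurability of the crux's arbitrary event `E`.

## Disproof.lean (cdisprove-13995-0, v7 06:13Z; NO KILL, no `-- Targets`) — honoured as in gen 2; §4/§4b (`μ' = −4` on even-sided
boxes) is exactly the exposure repaired here; §1 positivity domain + §5.1 kinematics are now INSIDE the stubs' events (flag).
-/

noncomputable section

open Matrix Complex Filter MeasureTheory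
open Literature.MathematicalPhysics.QuantumLattice Literature.MathematicalPhysics.QuantumFieldTheory
  Literature.Probability.LatticeModels
open Summit.QuantumFields.QCD.Theses.NestedDissectionSea

namespace Summit.QuantumFields.QCD.Cruxes.EarlyCrosserLaw.CellsInheritTorusExtinction

open scoped ComplexConjugate BigOperators

/-! ## §1 Registered stubs (`sorry` lives only here; every signature is tree-vocabulary only)

S1 `stub_zeroExtensionQuasimode` is LANDED (imported, same namespace). -/

/-- **S2′ — torus-local (Hermitian) extinction of early quasimodes AT the two-sidedly pinned data, ON THE PHYSICAL BRANCH,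
KINEMATICALLY ALLOWED BOXES, CAPPED MASSES (open; hardest; the TORUS content of (a′)).** For `N_f ∈ {2,3}`, every admissible `reg`
with `mcrit k → 0` and every `M₀ ≥ 0`: `∃ ℓ > 0 ∀ b₀ ≥ 2 ∀ m > M₀ ∃ c > 0 ∀ R > 0`, IF the lower pin (b) and the upper pin (b″) hold
at `(m, R)`, THEN `∀ ε > 0 ∀ᶠ k ∀ S` (`R ≤ a_k(2S+1)`; the prover CHOOSES the physical window `ℓ` — before `m`, as in the crux — and the
level `c`, which may depend on `m`): `∃ δ ≥ 0, Σ_{j<J} δ_j ≤ ε`, and for every box `(x,t)` (any corner, `t_i < b₀2^{j+2}`, `t_i ≤ 2S+1`,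
`t_i a_k ≤ ℓ`) the event "`∃ f` with `Σ_i(1 − cos(π/t_i)) ≤ −m_f(k)` (the box can cross above the valence line at all),
`∃ μ'` with `m_f(k) ≤ μ' ≤ c a_k m_f/Z_m − Σ_i(1 − cos(π/t_i))`, `∃ v ≠ 0` on the box with `Σ‖D_W(U,μ',1) v̂‖² ≤ (c a_k m_f/Z_m)² Σ‖v‖²`"
is MAJORISED at level `δ_j`
(`∃ g ≥ 0`, `≥ 1` on the event, `g·wt` integrable, `∫ g wt/∫ wt ≤ δ_j` under `wilsonMeasureFamily (reg.β k) S`,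
`wt = ∏_f ‖det D_W(m_f(k))‖`). Plausibly true: `min_{v ⊂ box}‖D_W(μ')v̂‖/‖v̂‖ ≥ min|spec Γ₅D_W(μ')|`, and above the line the
Hermitian Wilson operator has a gap `≍ Z·a m/Z_m` whose downward fluctuations are rare and shrink with `a` (DGLPT hep-lat/0512021;
Mohler–Schaefer 2020 `⟨n_neg⟩ ∝ a^{6.8}` at fixed volume); for FREE / constant-holonomy fields `W` is normal and
`σ_min(W − λ) = dist(λ, spec W) ≥ c√λ ≫ a_k` (no event); only covariantly smooth carriers of size `≥ s_free` qualify (flag), counted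
by the UV-convergent end of the instanton measure (`b = 11 − 2N_f/3 > 4`, Disproof §5). Why it might fail: `κ₀(SU(3)) < 4/b`
(Disproof §5.5); pseudospectral events more frequent than crossings; `c < 1` essential. Size: open (route tier; crux-sized).
Leans on: `wilsonDirac`, `wilsonMeasureFamily`, `fermionDet`, `QCDRegularisation`, `wilsonMeasure_map_torusConfigShift`,
`isHermitian_hermitianWilsonDirac`; MohlerSchaefer2020, DebbioEtAl2006, Wegner1981DensityOfStates, GoltermanShamir2003. -/
theorem stub_torusLocalExtinctionOnBranch :
    ∀ Nf : ℕ, (Nf = 2 ∨ Nf = 3) → ∀ reg : QCDRegularisation Nf, reg.HasMassScaling →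
      (reg.scheme 0 0 0).HasAsymptoticScaling → Filter.Tendsto reg.mcrit Filter.atTop (nhds 0) →
      ∀ M₀ : ℝ, 0 ≤ M₀ →
      ∃ ℓ : ℝ, 0 < ℓ ∧ ∀ b₀ : ℕ, 2 ≤ b₀ → ∀ m : Fin Nf → ℝ, (∀ f, M₀ < m f) → ∃ c : ℝ, 0 < c ∧
        ∀ R : ℝ, 0 < R →
        (∀ M : ℝ, M₀ < M → ∀ᶠ k : ℕ in Filter.atTop, ∀ S : ℕ, R ≤ reg.a k * (2 * S + 1) →
          (1 / 4 : ℝ) ≤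
            (∫ U, (if (fermionDet (wilsonDirac (fundamentalRep (Fin 3)) U
                  (reg.mcrit k - reg.a k * M / reg.Zm k) 1)).re < 0 then (1 : ℝ) else 0) *
                (∏ f, ‖fermionDet (wilsonDirac (fundamentalRep (Fin 3)) U
                  (reg.mcrit k + reg.a k * m f / reg.Zm k) 1)‖) ∂(wilsonMeasureFamily (reg.β k) S)) /
            (∫ U, (∏ f, ‖fermionDet (wilsonDirac (fundamentalRep (Fin 3)) U
                  (reg.mcrit k + reg.a k * m f / reg.Zm k) 1)‖) ∂(wilsonMeasureFamily (reg.β k) S))) →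
        (∀ M : ℝ, M₀ < M → ∀ᶠ k : ℕ in Filter.atTop, ∀ S : ℕ, R ≤ reg.a k * (2 * S + 1) →
          reg.a k * (2 * S + 1) ≤ 2 * R →
            (∫ U, (if (fermionDet (wilsonDirac (fundamentalRep (Fin 3)) U
                  (reg.mcrit k + reg.a k * M / reg.Zm k) 1)).re < 0 then (1 : ℝ) else 0) *
                (∏ f, ‖fermionDet (wilsonDirac (fundamentalRep (Fin 3)) U
                  (reg.mcrit k + reg.a k * m f / reg.Zm k) 1)‖) ∂(wilsonMeasureFamily (reg.β k) S)) /
            (∫ U, (∏ f, ‖fermionDet (wilsonDirac (fundamentalRep (Fin 3)) U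
                  (reg.mcrit k + reg.a k * m f / reg.Zm k) 1)‖) ∂(wilsonMeasureFamily (reg.β k) S))
              ≤ (1 / 8 : ℝ)) →
        ∀ ε : ℝ, 0 < ε → ∀ᶠ k : ℕ in Filter.atTop, ∀ S : ℕ,
          R ≤ reg.a k * (2 * S + 1) →
          ∃ δ : ℕ → ℝ, (∀ j, 0 ≤ δ j) ∧
            ∑ j ∈ Finset.range (Nat.log 2 (⌊ℓ / reg.a k⌋₊ / b₀) + 1), δ j ≤ ε ∧
            ∀ j < Nat.log 2 (⌊ℓ / reg.a k⌋₊ / b₀) + 1,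
              ∀ (x : TorusSite 4 (2 * S + 1)) (t : Fin 4 → ℕ),
                (∀ i, t i < b₀ * 2 ^ (j + 2) ∧ t i ≤ 2 * S + 1 ∧ (t i : ℝ) * reg.a k ≤ ℓ) →
                ∃ g : GaugeConfig 4 (2 * S + 1) SU3 → ℝ, (∀ U, 0 ≤ g U) ∧
                  (∀ U, (∃ f : Fin Nf,
                      (∑ i, (1 - Real.cos (Real.pi / t i))) ≤ -(reg.mcrit k + reg.a k * m f / reg.Zm k) ∧
                      ∃ μ' : ℝ, reg.mcrit k + reg.a k * m f / reg.Zm k ≤ μ' ∧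
                      μ' + (∑ i, (1 - Real.cos (Real.pi / t i))) ≤ c * (reg.a k * m f / reg.Zm k) ∧
                      ∃ v : {p // wilsonBox x t p} → ℂ, v ≠ 0 ∧
                        ∑ p, ‖(wilsonDirac (fundamentalRep (Fin 3)) U μ' 1 *ᵥ
                            fun q => if h : wilsonBox x t q then v ⟨q, h⟩ else 0) p‖ ^ 2 ≤
                          (c * (reg.a k * m f / reg.Zm k)) ^ 2 * ∑ q, ‖v q‖ ^ 2) → 1 ≤ g U) ∧
                  MeasureTheory.Integrable (fun U => g U *
                    (∏ f, ‖fermionDet (wilsonDirac (fundamentalRep (Fin 3)) U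
                      (reg.mcrit k + reg.a k * m f / reg.Zm k) 1)‖)) (wilsonMeasureFamily (reg.β k) S) ∧
                  (∫ U, g U * (∏ f, ‖fermionDet (wilsonDirac (fundamentalRep (Fin 3)) U
                      (reg.mcrit k + reg.a k * m f / reg.Zm k) 1)‖) ∂(wilsonMeasureFamily (reg.β k) S)) /
                    (∫ U, (∏ f, ‖fermionDet (wilsonDirac (fundamentalRep (Fin 3)) U
                      (reg.mcrit k + reg.a k * m f / reg.Zm k) 1)‖) ∂(wilsonMeasureFamily (reg.β k) S))
                    ≤ δ j := by
  sorry

/-- **S3′ — sheet-attached (face-heavy) early crossers are window-rare at the pinned line, ON THE PHYSICAL BRANCH,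
KINEMATICALLY ALLOWED BOXES, CAPPED MASSES (open; the cell-specific content of (a′); the line's own lever).** Same hypotheses as
S2′ (branch; pins AT `(m, R)`), for EVERY level `c > 0`: the event "`∃ f` with `Σ_i(1 − cos(π/t_i)) ≤ −m_f(k)`,
`∃ μ'` with `m_f(k) ≤ μ' ≤ −Σ_i(1 − cos(π/t_i))`, the Dirichlet cell of `(x,t)` has a
kernel vector `w ≠ 0` with `(c a_k m_f/(8Z_m))² Σ‖w‖² < faceMass(w)`" is majorised at level `δ_j`, `Σ_{j<J}δ_j ≤ ε`. Populations:
near-sheet LUMPS (Dirichlet cutting raises `⟨w, W_U w⟩`, so a cut lump crosses LATER; boundary-layer entropy only) and WALL STATES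
(Kaplan/Shamir: by the universal face commutator a real mode not powered by interior curvature is γ_μ-polarised on a face layer
backed by a SUPERCRITICAL collar — above the pinned line a large deviation: a Compton-size shallow cold slab `e^{−c/(h²g⁴)}` or a
deep `s_free`-size cold spot `e^{−cβ² log β}`, both `≪ a_k⁴`). Why it might fail: rough intermediate-size carriers hybridising with
a sheet; the unproved sign in the face-coupling law of motion. The gen-2 exposure (one-site / even-sided boxes at a line `≤ −4`)
is gone: on the branch `m_f(k) → 0⁻` and uncharged boxes include every fixed size eventually. Size: open (crux-sized). Leans on:
`wilsonCell`, `wilsonBox`, `halfSides`, `KineticEdge`, Kaplan1992, Shamir1993, Luscher2003SchwarzDD, CeGiustiSchaefer2017. -/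
theorem stub_sheetAttachedRarityOnBranch :
    ∀ Nf : ℕ, (Nf = 2 ∨ Nf = 3) → ∀ reg : QCDRegularisation Nf, reg.HasMassScaling →
      (reg.scheme 0 0 0).HasAsymptoticScaling → Filter.Tendsto reg.mcrit Filter.atTop (nhds 0) →
      ∀ M₀ : ℝ, 0 ≤ M₀ →
      ∀ c : ℝ, 0 < c → ∀ b₀ : ℕ, 2 ≤ b₀ → ∀ ℓ : ℝ, 0 < ℓ → ∀ m : Fin Nf → ℝ, (∀ f, M₀ < m f) →
        ∀ R : ℝ, 0 < R →
        (∀ M : ℝ, M₀ < M → ∀ᶠ k : ℕ in Filter.atTop, ∀ S : ℕ, R ≤ reg.a k * (2 * S + 1) →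
          (1 / 4 : ℝ) ≤
            (∫ U, (if (fermionDet (wilsonDirac (fundamentalRep (Fin 3)) U
                  (reg.mcrit k - reg.a k * M / reg.Zm k) 1)).re < 0 then (1 : ℝ) else 0) *
                (∏ f, ‖fermionDet (wilsonDirac (fundamentalRep (Fin 3)) U
                  (reg.mcrit k + reg.a k * m f / reg.Zm k) 1)‖) ∂(wilsonMeasureFamily (reg.β k) S)) /
            (∫ U, (∏ f, ‖fermionDet (wilsonDirac (fundamentalRep (Fin 3)) U
                  (reg.mcrit k + reg.a k * m f / reg.Zm k) 1)‖) ∂(wilsonMeasureFamily (reg.β k) S))) →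
        (∀ M : ℝ, M₀ < M → ∀ᶠ k : ℕ in Filter.atTop, ∀ S : ℕ, R ≤ reg.a k * (2 * S + 1) →
          reg.a k * (2 * S + 1) ≤ 2 * R →
            (∫ U, (if (fermionDet (wilsonDirac (fundamentalRep (Fin 3)) U
                  (reg.mcrit k + reg.a k * M / reg.Zm k) 1)).re < 0 then (1 : ℝ) else 0) *
                (∏ f, ‖fermionDet (wilsonDirac (fundamentalRep (Fin 3)) U
                  (reg.mcrit k + reg.a k * m f / reg.Zm k) 1)‖) ∂(wilsonMeasureFamily (reg.β k) S)) /
            (∫ U, (∏ f, ‖fermionDet (wilsonDirac (fundamentalRep (Fin 3)) U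
                  (reg.mcrit k + reg.a k * m f / reg.Zm k) 1)‖) ∂(wilsonMeasureFamily (reg.β k) S))
              ≤ (1 / 8 : ℝ)) →
        ∀ ε : ℝ, 0 < ε → ∀ᶠ k : ℕ in Filter.atTop, ∀ S : ℕ,
          R ≤ reg.a k * (2 * S + 1) →
          ∃ δ : ℕ → ℝ, (∀ j, 0 ≤ δ j) ∧
            ∑ j ∈ Finset.range (Nat.log 2 (⌊ℓ / reg.a k⌋₊ / b₀) + 1), δ j ≤ ε ∧
            ∀ j < Nat.log 2 (⌊ℓ / reg.a k⌋₊ / b₀) + 1,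
              ∀ (x : TorusSite 4 (2 * S + 1)) (t : Fin 4 → ℕ),
                (∀ i, t i < b₀ * 2 ^ (j + 2) ∧ t i ≤ 2 * S + 1 ∧ (t i : ℝ) * reg.a k ≤ ℓ) →
                ∃ g : GaugeConfig 4 (2 * S + 1) SU3 → ℝ, (∀ U, 0 ≤ g U) ∧
                  (∀ U, (∃ f : Fin Nf,
                      (∑ i, (1 - Real.cos (Real.pi / t i))) ≤ -(reg.mcrit k + reg.a k * m f / reg.Zm k) ∧
                      ∃ μ' : ℝ, reg.mcrit k + reg.a k * m f / reg.Zm k ≤ μ' ∧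
                      μ' + (∑ i, (1 - Real.cos (Real.pi / t i))) ≤ 0 ∧
                      ∃ w : {p // wilsonBox x t p} → ℂ, w ≠ 0 ∧ wilsonCell U μ' x t *ᵥ w = 0 ∧
                        (c * (reg.a k * m f / reg.Zm k) / 8) ^ 2 * ∑ q, ‖w q‖ ^ 2 <
                          ∑ q : {p // wilsonBox x t p},
                            (if (∃ i, (q.1.1 i - x i).val = 1 ∨ (q.1.1 i - x i).val + 1 = t i)
                              then ‖w q‖ ^ 2 else 0)) → 1 ≤ g U) ∧
                  MeasureTheory.Integrable (fun U => g U *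
                    (∏ f, ‖fermionDet (wilsonDirac (fundamentalRep (Fin 3)) U
                      (reg.mcrit k + reg.a k * m f / reg.Zm k) 1)‖)) (wilsonMeasureFamily (reg.β k) S) ∧
                  (∫ U, g U * (∏ f, ‖fermionDet (wilsonDirac (fundamentalRep (Fin 3)) U
                      (reg.mcrit k + reg.a k * m f / reg.Zm k) 1)‖) ∂(wilsonMeasureFamily (reg.β k) S)) /
                    (∫ U, (∏ f, ‖fermionDet (wilsonDirac (fundamentalRep (Fin 3)) U
                      (reg.mcrit k + reg.a k * m f / reg.Zm k) 1)‖) ∂(wilsonMeasureFamily (reg.β k) S))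
                    ≤ δ j := by
  sorry

/-- **S4′ `stub_pinnedLineOnBranch` — the two-sided parity pin is realised ON THE PHYSICAL BRANCH (open; shared physics
node of all lines of this crux; RobustYangMills class).** Clauses (b) ∧ (b″) of the crux with its own `∃ reg` (HasMassScaling,
HasAsymptoticScaling) and `∃ M₀`, verbatim (measure spelled `wilsonMeasureFamily`), PLUS `mcrit k → 0` for the same witness
(`m_c(g₀) = −g₀²Σ₁ + O(g₀⁴) → 0`; free for every honest witness; implies gen-2's `stub_pinnedLine` by forgetting). Content:
(b) = topological-charge parity `P(Q odd) ≥ ¼` on tori of physical side `≥ R` surviving the continuum limit; (b″) = Mohler–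
Schaefer's `⟨n_neg⟩ → 0` at fixed physical volume. Wave-1 audit (worker): no junk either way (β_k/Λ/a-rate/Z_m-scale/M₀/R
freedoms only rescale units; no U-independent determinant sign on odd tori; denominators > 0); nearest existing item
`NegativeCellsDilute` (stmt-13900) clause (b) (lower pin only, own `∃ reg`); NO existing item states (b″). Size: open. -/
theorem stub_pinnedLineOnBranch :
    ∀ Nf : ℕ, (Nf = 2 ∨ Nf = 3) → ∃ reg : QCDRegularisation Nf, reg.HasMassScaling ∧
      (reg.scheme 0 0 0).HasAsymptoticScaling ∧ Filter.Tendsto reg.mcrit Filter.atTop (nhds 0) ∧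
      ∃ M₀ : ℝ, 0 ≤ M₀ ∧
      ∀ m : Fin Nf → ℝ, (∀ f, M₀ < m f) → ∃ R : ℝ, 0 < R ∧
        (∀ M : ℝ, M₀ < M → ∀ᶠ k : ℕ in Filter.atTop, ∀ S : ℕ, R ≤ reg.a k * (2 * S + 1) →
          (1 / 4 : ℝ) ≤
            (∫ U, (if (fermionDet (wilsonDirac (fundamentalRep (Fin 3)) U
                  (reg.mcrit k - reg.a k * M / reg.Zm k) 1)).re < 0 then (1 : ℝ) else 0) *
                (∏ f, ‖fermionDet (wilsonDirac (fundamentalRep (Fin 3)) U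
                  (reg.mcrit k + reg.a k * m f / reg.Zm k) 1)‖) ∂(wilsonMeasureFamily (reg.β k) S)) /
            (∫ U, (∏ f, ‖fermionDet (wilsonDirac (fundamentalRep (Fin 3)) U
                  (reg.mcrit k + reg.a k * m f / reg.Zm k) 1)‖) ∂(wilsonMeasureFamily (reg.β k) S))) ∧
        (∀ M : ℝ, M₀ < M → ∀ᶠ k : ℕ in Filter.atTop, ∀ S : ℕ, R ≤ reg.a k * (2 * S + 1) →
          reg.a k * (2 * S + 1) ≤ 2 * R →
            (∫ U, (if (fermionDet (wilsonDirac (fundamentalRep (Fin 3)) U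
                  (reg.mcrit k + reg.a k * M / reg.Zm k) 1)).re < 0 then (1 : ℝ) else 0) *
                (∏ f, ‖fermionDet (wilsonDirac (fundamentalRep (Fin 3)) U
                  (reg.mcrit k + reg.a k * m f / reg.Zm k) 1)‖) ∂(wilsonMeasureFamily (reg.β k) S)) /
            (∫ U, (∏ f, ‖fermionDet (wilsonDirac (fundamentalRep (Fin 3)) U
                  (reg.mcrit k + reg.a k * m f / reg.Zm k) 1)‖) ∂(wilsonMeasureFamily (reg.β k) S))
              ≤ (1 / 8 : ℝ)) := by
  sorry

/-! ## §2 Composition (sorry-free; cites the three open stubs, the landed S1 and the landed `outer_union_bound` by name) -/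

open scoped Classical in
/-- **The crux, by name**: `reg`, branch, `M₀`, pin from S4′; `ℓ`, then `c` (after `m`) from S2′; `R` and the two pin clauses at
`(m, R)` from S4′, fed to S2′ and to S3′ (at `c, ℓ`); `b₀ := 2`; (b), (b″) verbatim; (a′): a crossing at `μ' ≥ m_f(k)` in one of the 17
boxes gives the kinematic flag and the cap (`kineticEdge_zeroMode`, `quasimode_kineticEdge`) and, by the face dichotomy + S1, one of the
two charged events; `outer_union_bound`, `δ_j = 17(δ²_j + δ³_j)`. -/
theorem EarlyCrosserLaw_of : EarlyCrosserLaw := by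
  intro Nf hNf
  obtain ⟨reg, hms, has, hmc, M₀, hM₀, hpin⟩ := stub_pinnedLineOnBranch Nf hNf
  obtain ⟨ℓ, hℓ, hext⟩ := stub_torusLocalExtinctionOnBranch Nf hNf reg hms has hmc M₀ hM₀
  refine ⟨reg, hms, has, M₀, hM₀, 2, le_rfl, ℓ, hℓ, fun m hm => ?_⟩
  obtain ⟨c, hc, hext'⟩ := hext 2 le_rfl m hm
  obtain ⟨R, hR, hlow, hup⟩ := hpin m hm
  have hext'' := hext' R hR hlow hup
  have hsheet := stub_sheetAttachedRarityOnBranch Nf hNf reg hms has hmc M₀ hM₀ c hc 2 le_rfl ℓ hℓ m hm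
    R hR hlow hup
  refine ⟨R, hR, ?_, hlow, hup⟩
  -- clause (a′)
  intro ε hε
  have hε' : 0 < ε / 34 := by positivity
  filter_upwards [hext'' (ε / 34) hε', hsheet (ε / 34) hε'] with k hk₂ hk₃
  intro S hS
  obtain ⟨δ₂, hδ₂0, hδ₂s, H₂⟩ := hk₂ S hS
  obtain ⟨δ₃, hδ₃0, hδ₃s, H₃⟩ := hk₃ S hS
  dsimp only
  refine ⟨fun j => 17 * (δ₂ j + δ₃ j), fun j => ?_, ?_, ?_⟩
  · have := hδ₂0 j; have := hδ₃0 j; positivity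
  · rw [← Finset.mul_sum, Finset.sum_add_distrib]; linarith
  intro j hj s hs E hE
  -- the 17 boxes: `none` = the parent `(0, s)`, `some c'` = the child `c'`
  let xo : Option (Fin 4 → Bool) → TorusSite 4 (2 * S + 1) := fun o => o.elim 0 fun c' => halfCorner s c'
  let ts : Option (Fin 4 → Bool) → (Fin 4 → ℕ) := fun o => o.elim s fun c' => halfSides s c'
  have hto : ∀ o i, ts o i ≤ s i := by
    rintro (_ | c') i
    · exact le_rfl
    · exact halfSides_le s c' i
  have hbox : ∀ o i, ts o i < 2 * 2 ^ (j + 2) ∧ ts o i ≤ 2 * S + 1 ∧ (ts o i : ℝ) * reg.a k ≤ ℓ := by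
    intro o i
    obtain ⟨-, h2, h3, h4⟩ := hs i
    refine ⟨lt_of_le_of_lt (hto o i) h2, (hto o i).trans h3, le_trans ?_ h4⟩
    exact mul_le_mul_of_nonneg_right (Nat.cast_le.mpr (hto o i)) (reg.a_pos k).le
  -- the weight and the two charged event families
  have hwt : ∀ U : GaugeConfig 4 (2 * S + 1) SU3,
      0 ≤ ∏ f, ‖fermionDet (wilsonDirac (fundamentalRep (Fin 3)) U
        (reg.mcrit k + reg.a k * m f / reg.Zm k) 1)‖ :=
    fun U => Finset.prod_nonneg fun f _ => norm_nonneg _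
  let A₂ : Option (Fin 4 → Bool) → GaugeConfig 4 (2 * S + 1) SU3 → Prop := fun o U =>
    ∃ f : Fin Nf, (∑ i, (1 - Real.cos (Real.pi / ts o i))) ≤ -(reg.mcrit k + reg.a k * m f / reg.Zm k) ∧
      ∃ μ' : ℝ, reg.mcrit k + reg.a k * m f / reg.Zm k ≤ μ' ∧
      μ' + (∑ i, (1 - Real.cos (Real.pi / ts o i))) ≤ c * (reg.a k * m f / reg.Zm k) ∧
      ∃ v : {p // wilsonBox (xo o) (ts o) p} → ℂ, v ≠ 0 ∧
        ∑ p, ‖(wilsonDirac (fundamentalRep (Fin 3)) U μ' 1 *ᵥ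
            fun q => if h : wilsonBox (xo o) (ts o) q then v ⟨q, h⟩ else 0) p‖ ^ 2 ≤
          (c * (reg.a k * m f / reg.Zm k)) ^ 2 * ∑ q, ‖v q‖ ^ 2
  let A₃ : Option (Fin 4 → Bool) → GaugeConfig 4 (2 * S + 1) SU3 → Prop := fun o U =>
    ∃ f : Fin Nf, (∑ i, (1 - Real.cos (Real.pi / ts o i))) ≤ -(reg.mcrit k + reg.a k * m f / reg.Zm k) ∧
      ∃ μ' : ℝ, reg.mcrit k + reg.a k * m f / reg.Zm k ≤ μ' ∧
      μ' + (∑ i, (1 - Real.cos (Real.pi / ts o i))) ≤ 0 ∧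
      ∃ w : {p // wilsonBox (xo o) (ts o) p} → ℂ, w ≠ 0 ∧
        wilsonCell U μ' (xo o) (ts o) *ᵥ w = 0 ∧
        (c * (reg.a k * m f / reg.Zm k) / 8) ^ 2 * ∑ q, ‖w q‖ ^ 2 <
          ∑ q : {p // wilsonBox (xo o) (ts o) p},
            (if (∃ i, (q.1.1 i - xo o i).val = 1 ∨ (q.1.1 i - xo o i).val + 1 = ts o i)
              then ‖w q‖ ^ 2 else 0)
  -- every crossing of a parent/child cell above a valence line lands in one of the two families
  have key : ∀ (o : Option (Fin 4 → Bool)) (U : GaugeConfig 4 (2 * S + 1) SU3) (f : Fin Nf) (μ' : ℝ),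
      reg.mcrit k + reg.a k * m f / reg.Zm k ≤ μ' → (wilsonCell U μ' (xo o) (ts o)).det = 0 →
      A₂ o U ∨ A₃ o U := by
    intro o U f μ' hμ' hdet
    -- kinematic flag from the crossing itself (landed kinetic edge (a))
    have hedge := Summit.QuantumFields.QCD.Theorems.KineticEdge.kineticEdge_zeroMode U (ts o) μ' (xo o)
        (fun i => (hbox o i).2.1) hdet
    have hflag : (∑ i, (1 - Real.cos (Real.pi / ts o i))) ≤ -(reg.mcrit k + reg.a k * m f / reg.Zm k) :=
      le_trans hedge (neg_le_neg hμ')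
    have hcap₃ : μ' + (∑ i, (1 - Real.cos (Real.pi / ts o i))) ≤ 0 := by linarith
    have hη : 0 ≤ c * (reg.a k * m f / reg.Zm k) := by
      have := reg.a_pos k; have := reg.Zm_pos k; have := (hM₀.trans_lt (hm f)).le
      positivity
    obtain ⟨w, hw0, hw⟩ := Matrix.exists_mulVec_eq_zero_iff.mpr hdet
    by_cases hface :
        (∑ q : {p // wilsonBox (xo o) (ts o) p},
            (if (∃ i, (q.1.1 i - xo o i).val = 1 ∨ (q.1.1 i - xo o i).val + 1 = ts o i)
              then ‖w q‖ ^ 2 else 0)) ≤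
          (c * (reg.a k * m f / reg.Zm k) / 8) ^ 2 * ∑ q, ‖w q‖ ^ 2
    · left
      have hleak := stub_zeroExtensionQuasimode (2 * S + 1) U μ' (xo o) (ts o) w
        (fun i => (hbox o i).2.1) hw
      have hq : ∑ p, ‖(wilsonDirac (fundamentalRep (Fin 3)) U μ' 1 *ᵥ
              fun q => if h : wilsonBox (xo o) (ts o) q then w ⟨q, h⟩ else 0) p‖ ^ 2 ≤
            (c * (reg.a k * m f / reg.Zm k)) ^ 2 * ∑ q, ‖w q‖ ^ 2 :=
        calc ∑ p, ‖(wilsonDirac (fundamentalRep (Fin 3)) U μ' 1 *ᵥ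
                fun q => if h : wilsonBox (xo o) (ts o) q then w ⟨q, h⟩ else 0) p‖ ^ 2
            ≤ 64 * ∑ q : {p // wilsonBox (xo o) (ts o) p},
                (if (∃ i, (q.1.1 i - xo o i).val = 1 ∨ (q.1.1 i - xo o i).val + 1 = ts o i)
                  then ‖w q‖ ^ 2 else 0) := hleak
          _ ≤ 64 * ((c * (reg.a k * m f / reg.Zm k) / 8) ^ 2 * ∑ q, ‖w q‖ ^ 2) :=
              mul_le_mul_of_nonneg_left hface (by norm_num)
          _ = (c * (reg.a k * m f / reg.Zm k)) ^ 2 * ∑ q, ‖w q‖ ^ 2 := by ring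
      have hcap₂ := quasimode_kineticEdge U μ' (xo o) (ts o) (fun i => (hbox o i).2.1) hη w hw0 hq
      exact ⟨f, hflag, μ', hμ', hcap₂, w, hw0, hq⟩
    · right
      exact ⟨f, hflag, μ', hμ', hcap₃, w, hw0, hw, lt_of_not_ge hface⟩
  have hA : ∀ i : Option (Fin 4 → Bool) ⊕ Option (Fin 4 → Bool),
      ∃ g : GaugeConfig 4 (2 * S + 1) SU3 → ℝ, (∀ U, 0 ≤ g U) ∧
        (∀ U, Sum.elim A₂ A₃ i U → 1 ≤ g U) ∧
        Integrable (fun U => g U * ∏ f, ‖fermionDet (wilsonDirac (fundamentalRep (Fin 3)) U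
          (reg.mcrit k + reg.a k * m f / reg.Zm k) 1)‖) (wilsonMeasureFamily (reg.β k) S) ∧
        (∫ U, g U * ∏ f, ‖fermionDet (wilsonDirac (fundamentalRep (Fin 3)) U
            (reg.mcrit k + reg.a k * m f / reg.Zm k) 1)‖ ∂(wilsonMeasureFamily (reg.β k) S)) /
          (∫ U, ∏ f, ‖fermionDet (wilsonDirac (fundamentalRep (Fin 3)) U
            (reg.mcrit k + reg.a k * m f / reg.Zm k) 1)‖ ∂(wilsonMeasureFamily (reg.β k) S)) ≤
          Sum.elim (fun _ => δ₂ j) (fun _ => δ₃ j) i := by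
    rintro (o | o)
    · exact H₂ j hj (xo o) (ts o) (hbox o)
    · exact H₃ j hj (xo o) (ts o) (hbox o)
  have hE' : ∀ U, E U → ∃ i : Option (Fin 4 → Bool) ⊕ Option (Fin 4 → Bool), Sum.elim A₂ A₃ i U := by
    intro U hU
    obtain ⟨f, μ', hμ', hsing⟩ := hE U hU
    rcases hsing with h0 | ⟨c', hc'⟩
    · rcases key none U f μ' hμ' h0 with h | h
      · exact ⟨Sum.inl none, h⟩
      · exact ⟨Sum.inr none, h⟩
    · rcases key (some c') U f μ' hμ' hc' with h | h
      · exact ⟨Sum.inl (some c'), h⟩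
      · exact ⟨Sum.inr (some c'), h⟩
  have hδsum : ∑ i : Option (Fin 4 → Bool) ⊕ Option (Fin 4 → Bool),
      Sum.elim (fun _ => δ₂ j) (fun _ => δ₃ j) i = 17 * (δ₂ j + δ₃ j) := by
    rw [Fintype.sum_sum_type]
    simp only [Sum.elim_inl, Sum.elim_inr, Finset.sum_const, Finset.card_univ, Fintype.card_option,
      Fintype.card_fun, Fintype.card_bool, Fintype.card_fin, nsmul_eq_mul]
    norm_num
    ring
  calc _ ≤ ∑ i : Option (Fin 4 → Bool) ⊕ Option (Fin 4 → Bool),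
        Sum.elim (fun _ => δ₂ j) (fun _ => δ₃ j) i := outer_union_bound hwt hA hE'
    _ = 17 * (δ₂ j + δ₃ j) := hδsum

end Summit.QuantumFields.QCD.Cruxes.EarlyCrosserLaw.CellsInheritTorusExtinction

end
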